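import Literature.Geometry.Riemannian.GradientEstimateIntegration
import Literature.Geometry.Lorentzian.Isometry
import Mathlib.Topology.Homotopy.Lifting
import HarnessLib

/-!
# Fibre points of a Riemannian covering over a well-covered ball are far apart

Let `f : (N, f^*g) → (M, g)` be a Riemannian covering (a covering map which is an
equidimensional immersion, carrying the pulled-back metric). If `U ⊆ M` is a set all of whose
loops at `y` are null-homotopic in `M` (e.g. a simply connected open neighbourhood) and the
`g`-ball of radius `r` about `y` lies in `U`, then two distinct points of the fibre `f⁻¹(y)` are
at `f^*g`-distance `≥ r`: a `C¹` path between them of `f^*g`-length `< r` would project to a loop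
at `y` of `g`-length `< r`, hence inside the ball, hence inside `U`, hence null-homotopic — but
a null-homotopic loop lifts to a loop (homotopy lifting, Hatcher 2002, Prop. 1.30), not to a path
between distinct fibre points. This is the metric form of the covering-space argument in the
proof of the rigid positive energy theorem (Beig–Chruściel, J. Math. Phys. 37 (1996), Thm. 4.1,
§4: "`Σ̃` has only one asymptotically flat end … it follows that `Σ = Σ̃`"), used in
`Literature/Geometry/Lorentzian` to show that one-ended data carrying translational Killing
initial data are simply connected.

* `length_eq_lintegral_Ioo` — the arc length as an integral over the open interval;
* `length_comp_comap` — **a local isometry preserves lengths**: `L_g(f ∘ γ) = L_{f^*g}(γ)`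
  for `γ` differentiable on the open parameter interval (O'Neill 1983, Ch. 3, pp. 90–91);
* `le_edist_comap_of_fibre` — **main result**, as above.

Everything is proved; no definitions, no named facts (D-0026).

## References

* A. Hatcher, *Algebraic Topology*, CUP 2002, §1.3, Prop. 1.30 (homotopy lifting), Prop. 1.31.
  [HatcherAT2002]
* B. O'Neill, *Semi-Riemannian geometry*, Academic Press 1983, Ch. 3, pp. 90–91; Ch. 7,
  pp. 201–202 (semi-Riemannian coverings). [ONeill1983]
* R. Beig, P. T. Chruściel, J. Math. Phys. 37 (1996) 1939–1961, proof of Thm. 4.1, §4.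
  [BeigChrusciel1996]
-/

noncomputable section

open Bundle Set Function Filter Manifold MeasureTheory
open scoped Manifold ContDiff Topology

namespace Literature.Geometry.Riemannian

open Literature.Geometry.Lorentzian
open Literature.Geometry.Lorentzian.PseudoRiemannianMetric

variable {E : Type*} [NormedAddCommGroup E] [NormedSpace ℝ E] {H : Type*} [TopologicalSpace H]
  {I : ModelWithCorners ℝ E H} {M : Type*} [TopologicalSpace M] [ChartedSpace H M]
  [IsManifold I ∞ M]
  {E' : Type*} [NormedAddCommGroup E'] [NormedSpace ℝ E'] {H' : Type*} [TopologicalSpace H']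
  {I' : ModelWithCorners ℝ E' H'} {N : Type*} [TopologicalSpace N] [ChartedSpace H' N]
  [IsManifold I' ∞ N] [FiniteDimensional ℝ E] [FiniteDimensional ℝ E']
  {g : PseudoRiemannianMetric I ∞ E (TangentSpace I : M → Type _)}
  {f : N → M} {hpb : contMDiff_pullbackBilin I M I' N ∞} {hf : ContMDiff I' I (∞ + 1) f}
  {hf' : ∀ u, Injective (mfderiv I' I f u)} {hdim : Module.finrank ℝ E' = Module.finrank ℝ E}

/-! ### Lengths under a local isometry -/

/-- **The printed arc-length formula over the open interval**:
`L(γ|[a,b]) = ∫_{(a,b)} g(γ'(t), γ'(t))^{1/2} dt` (the endpoints have measure zero; O'Neill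
1983, Ch. 5, Def. 11). [cite: ONeill1983, Ch. 5, Def. 11 (p. 131)] -/
theorem length_eq_lintegral_Ioo (hg : g.IsRiemannian) (γ : ℝ → M) (a b : ℝ) :
    g.length hg γ a b = ∫⁻ t in Ioo a b,
      ENNReal.ofReal (Real.sqrt (g.val (γ t) (mfderiv 𝓘(ℝ, ℝ) I γ t 1) (mfderiv 𝓘(ℝ, ℝ) I γ t 1))) := by
  letI := g.riemannianBundle hg
  simp only [PseudoRiemannianMetric.length, pathELength_eq_lintegral_mfderiv_Ioo]
  refine lintegral_congr fun t ↦ ?_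
  rw [← ofReal_norm, g.norm_eq_sqrt hg]

/-- **A local isometry preserves arc length**: for the pulled-back metric `f^*g` along an
equidimensional immersion `f` and a curve `γ` in `N` differentiable on `(a, b)`,
`L_g(f ∘ γ|[a,b]) = L_{f^*g}(γ|[a,b])`, since `(f ∘ γ)' = df(γ')` and
`(f^*g)(γ', γ') = g(df γ', df γ')` (O'Neill 1983, Ch. 3, pp. 90–91: a local isometry
"preserves … lengths of curves"). [cite: ONeill1983, Ch. 3, pp. 90–91] -/
theorem length_comp_comap (hg : g.IsRiemannian) (hc : (g.comap hpb f hf hf' hdim).IsRiemannian)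
    {γ : ℝ → N} {a b : ℝ} (hγ : ∀ t ∈ Ioo a b, MDifferentiableAt 𝓘(ℝ, ℝ) I' γ t) :
    g.length hg (f ∘ γ) a b = (g.comap hpb f hf hf' hdim).length hc γ a b := by
  rw [length_eq_lintegral_Ioo, length_eq_lintegral_Ioo]
  refine setLIntegral_congr_fun measurableSet_Ioo fun t ht ↦ ?_
  have hft : MDifferentiableAt I' I f (γ t) :=
    ((hf.of_le le_self_add).contMDiffAt).mdifferentiableAt (by simp)
  have hcomp : HasMFDerivAt 𝓘(ℝ, ℝ) I (f ∘ γ) t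
      ((mfderiv I' I f (γ t)).comp (mfderiv 𝓘(ℝ, ℝ) I' γ t)) :=
    hft.hasMFDerivAt.comp t (hγ t ht).hasMFDerivAt
  rw [hcomp.mfderiv]
  simp only [comp_apply, val_comap, pullbackBilin_apply]
  rfl

/-! ### Fibre points over a well-covered ball are far apart -/

/-- **Distinct fibre points of a Riemannian covering over the centre of a ball inside a
loop-trivial set are at least the radius apart.** Let `f : N → M` be an equidimensional
immersion which is a covering map, `g` a smooth Riemannian metric on `M` with `f^*g` Riemannian,
`U ⊆ M` a set every loop in which based at `y` is null-homotopic (rel endpoints) in `M`, and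
suppose the open `g`-ball of radius `r` about `y` is contained in `U`. Then
`d_{f^*g}(a, b) ≥ r` for any two distinct points `a ≠ b` of `N` over `y`: a `C¹` path from `a`
to `b` of length `< r` projects to a loop at `y` of length `< r` (`length_comp_comap`), which
stays in the ball (the distance is bounded by the length), hence in `U`, hence is
null-homotopic; its lift from `a` is then a loop (Hatcher 2002, Prop. 1.30,
`IsCoveringMap.liftPath_apply_one_eq_of_homotopicRel`), whereas by uniqueness of lifts it is the
original path ending at `b ≠ a`. (The covering step "`Σ = Σ̃`" of the proof of Beig–Chruściel
1996, Thm. 4.1, §4, in metric form.) [cite: HatcherAT2002, Prop. 1.30 and Prop. 1.31] -/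
theorem le_edist_comap_of_fibre (hg : g.IsRiemannian)
    (hc : (g.comap hpb f hf hf' hdim).IsRiemannian) (hcov : IsCoveringMap f) {U : Set M} {y : M}
    {r : ENNReal}
    (hU : ∀ γ : C(unitInterval, M), (∀ t, γ t ∈ U) → γ 0 = y → γ 1 = y →
      γ.HomotopicRel (ContinuousMap.const unitInterval y) {0, 1})
    (hball : {q | g.edist hg y q < r} ⊆ U) {a b : N} (ha : f a = y) (hb : f b = y) (hab : a ≠ b) :
    r ≤ (g.comap hpb f hf hf' hdim).edist hc a b := by
  by_contra hlt
  rw [not_le] at hlt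
  -- a short `C¹` path from `a` to `b`
  letI := (g.comap hpb f hf hf' hdim).riemannianBundle hc
  obtain ⟨γ, hγ0, hγ1, hγs, hlen⟩ := exists_lt_of_riemannianEDist_lt (I := I') (x := a) (y := b) hlt
  have hlen' : (g.comap hpb f hf hf' hdim).length hc γ 0 1 < r := hlen
  have hfs : ContMDiff I' I ∞ f := hf.of_le le_self_add
  -- its projection: a loop at `y` of length `< r`
  set σ : ℝ → M := f ∘ γ with hσ
  have hσs : ContMDiffOn 𝓘(ℝ, ℝ) I 1 σ (Icc 0 1) :=
    (hfs.of_le (by exact_mod_cast le_top)).comp_contMDiffOn hγs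
  have hσ0 : σ 0 = y := by simp [hσ, hγ0, ha]
  have hσ1 : σ 1 = y := by simp [hσ, hγ1, hb]
  have hσlen : g.length hg σ 0 1 < r := by
    rw [hσ, length_comp_comap hg hc fun t ht ↦
      (hγs.contMDiffAt (Icc_mem_nhds ht.1 ht.2)).mdifferentiableAt one_ne_zero]
    exact hlen'
  -- the loop stays in the ball, hence in `U`
  have hσU : ∀ t ∈ Icc (0 : ℝ) 1, σ t ∈ U := by
    intro t ht
    apply hball
    calc g.edist hg y (σ t) = g.edist hg (σ 0) (σ t) := by rw [hσ0]
      _ ≤ g.length hg σ 0 t := edist_le_length hg ht.1 (hσs.mono (Icc_subset_Icc_right ht.2))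
      _ ≤ g.length hg σ 0 1 := length_mono g hg σ le_rfl ht.2
      _ < r := hσlen
  -- the path and the loop as continuous maps on `I`
  have hγc : Continuous fun t : unitInterval ↦ γ t :=
    continuousOn_iff_continuous_restrict.1 hγs.continuousOn
  have hσc : Continuous fun t : unitInterval ↦ σ t :=
    continuousOn_iff_continuous_restrict.1 hσs.continuousOn
  set γI : C(unitInterval, N) := ⟨fun t ↦ γ t, hγc⟩ with hγI
  set σI : C(unitInterval, M) := ⟨fun t ↦ σ t, hσc⟩ with hσI
  have hσI0 : σI 0 = f a := by simp [hσI, hσ0, ha]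
  have hnull : σI.HomotopicRel (ContinuousMap.const unitInterval y) {0, 1} :=
    hU σI (fun t ↦ hσU t t.2) (by simp [hσI, hσ0]) (by simp [hσI, hσ1])
  -- homotopic paths lift to paths with the same endpoint …
  have h1 := hcov.liftPath_apply_one_eq_of_homotopicRel hnull a hσI0 (by simp [ha])
  rw [hcov.liftPath_const (by simp [ha])] at h1
  -- … and the lift of `σ` from `a` is `γ` itself
  have hlift : γI = hcov.liftPath σI a hσI0 :=
    (hcov.eq_liftPath_iff' hσI0).2 ⟨rfl, by simp [hγI, hγ0]⟩
  rw [← hlift] at h1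
  have : γ 1 = a := h1
  exact hab (this.symm.trans hγ1)

end Literature.Geometry.Riemannian

end
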